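import Summits.CriticalPhenomena.PercolationContinuityZ3.Theorems.PercNearOneGluingNoHeavyLowerTailCILStarTransfer
import Summits.CriticalPhenomena.PercolationContinuityZ3.Theorems.PercNearOneGluingNoHeavyLowerTailQuantitativeLonelierMember
import Summits.CriticalPhenomena.PercolationContinuityZ3.Theorems.PercNearOneGluingNoHeavyLowerTailCILReduction
import HarnessLib

/-!
# `NoHeavyLowerTail` (stmt-CriticalPhenomena-4575) — SET-GAP STABILITY ("hull ports as virtual pivots") closes the crux

Support file (prover `prim-hp-6`, hull-port cell, observer-set / OES technique; `--supports stmt-CriticalPhenomena-4575`).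
No definitions, no named facts, no sorries.

Notation: `μ = prodBernoulli w` on `Fin n`, relays `A`, level `j`, `π(v) = {x ∈ A : v ↔ x}`, `r(x) = μ{|π(x)| ≤ j}`
(the LIGHTNESS of `x`; a champion `c` maximises `r` over `A`), an observer SET `U` with `π(U) = ⋃_{u ∈ U} π(u)` and
`{q ↮ U}` = "`q` is joined to no vertex of `U`".  The set-champion-stability DEFICIT of a relay `q` against `U` is
`Δ(U, q) := μ(q ↮ U, 1 ≤ |π(U)| ≤ j) − μ(q ↮ U, |π(q)| ≤ j)`; the cell's WALL (prim-gen-swap MAX-TRANSFER.md §SYNTHESIS;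
prim-gen-induct's ≥ 3-gate STEP; the lead's ≥ 3-hull-port residual) is `Δ(B, c) ≤ 0` for the champion `c` of `G − o` and a
star `B` of light Steiner neighbours of the observer `o` (`Theorems.cil_of_starStability` reduces CIL at `o` to exactly this).

THE CONJECTURE OF THIS SEAT (census-clean; run/shared/lean/prim/prim-hp-6/NOTES-gen1.md R5, ttrl request
`hpsqg-hull-ports-virtual-pivots`, kit j047176).  **Set-gap stability (SQG):** for EVERY vertex set `U` and EVERY relay `q`,
`Δ(U, q) ≤ max_{a ∈ A} r(a) − r(q)`; sharper **hull-port form (HP-SQG):** `Δ(U, q) ≤ max_{p ∈ P(U)} r(p) − r(q)` with `P(U)` the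
relays adjacent to the Steiner hull of `U`.  The tree's quantitative lonelier-member lemma
(`CutObserver.observerSet_le_add_posPart`, van den Berg–Häggström–Kahn Thm 1.5) is `Δ(U, q) ≤ (r(y) − r(q))⁺` for a MEMBER
`y ∈ U`; SQG / HP-SQG say that the champion / the hull ports may serve as VIRTUAL members.  At `q = c` SQG is the wall; at
`q =` best port HP-SQG is "the best hull port is a valid CIL witness for the glued set `U`"; for `|U| = 1` with relay
neighbours it is `Theorems.cil_relayNeighbours_port`.  Exact census (this seat, n ≤ 7, all `q`, `|U| ≤ 3`): 0 violations in
> 1.9·10⁵ cases; equality only for `U` glued to a port.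

This file records, sorry-free:
* `setGap_of_member_le` — SQG HOLDS whenever `U` has a member `y` with `r(y) ≤ r(c)` (a relay, or a heavy Steiner vertex):
  immediate from the quantitative lonelier-member lemma.  So the open case of SQG is exactly "all members of `U` lighter than
  the champion" — the wall's light Steiner stars, now for an arbitrary witness `q`.
* `cil_of_setGap_deleted` — CIL_j at an observer `o ∉ A` with the witness `c` = a champion of the observer-DELETED weights
  `w ∖ o`, from the wall inequalities `Δ_{w∖o}(B, c) ≤ 0` for the nonempty sets `B` of light non-relay neighbours of `o`, stated
  directly for the measure `prodBernoulli (w ∖ o)` (the form in which SQG is conjectured; `Theorems.cil_of_starStability` wants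
  them read off `ω ∩ {e | o ∉ e}` — the transfer is `CutObserver.measureReal_preimage_avoid`).
* `noHeavyLowerTail_of_setGapStability` — **SQG (for Steiner sets, all graphs) ⇒ `NoHeavyLowerTail`**, via
  `cil_of_setGap_deleted` and `Theorems.noHeavyLowerTail_of_stub_cumulativeIsolation`.  (HP-SQG ⇒ SQG trivially, ports being
  relays.)  This is a conditional reduction: the item stays open; SQG is the typed residual of the observer-set line.
-/

noncomputable section

namespace Summit.CriticalPhenomena.PercolationContinuityZ3.Theorems

open MeasureTheory Set Literature.Probability.LatticeModels Literature.Probability.Percolation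
open scoped Classical BigOperators

variable {n : ℕ}

/-- **Set-gap stability with a non-light member** (the known case of SQG).  For any observer set `U`, any member `y ∈ U`
and any vertices `q, c` with `r(q) ≤ r(c)` and `r(y) ≤ r(c)`:
`μ(q ↮ U, 1 ≤ |π(U)| ≤ j) + r(q) ≤ μ(q ↮ U, |π(q)| ≤ j) + r(c)`, i.e. `Δ(U, q) ≤ r(c) − r(q)`.
Proof: the quantitative lonelier-member lemma gives `Δ(U, q) ≤ (r(y) − r(q))⁺ ≤ r(c) − r(q)`.
[cite: VandenbergHaggstromKahn2005, Thm. 1.5 (p. 7) — via `CutObserver.observerSet_le_add_posPart`] -/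
theorem setGap_of_member_le (w : Sym2 (Fin n) → unitInterval) (A U : Finset (Fin n)) (y q c : Fin n)
    (hy : y ∈ U) (j : ℕ)
    (hq : (prodBernoulli w).real {ω : BondConfig (Fin n) | (A.filter fun z => ω ∈ openConn q z).card ≤ j} ≤
      (prodBernoulli w).real {ω : BondConfig (Fin n) | (A.filter fun z => ω ∈ openConn c z).card ≤ j})
    (hyc : (prodBernoulli w).real {ω : BondConfig (Fin n) | (A.filter fun z => ω ∈ openConn y z).card ≤ j} ≤
      (prodBernoulli w).real {ω : BondConfig (Fin n) | (A.filter fun z => ω ∈ openConn c z).card ≤ j}) :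
    (prodBernoulli w).real {ω : BondConfig (Fin n) | (∀ x ∈ U, ω ∉ openConn q x) ∧
        1 ≤ (A.filter fun z => ∃ x ∈ U, ω ∈ openConn x z).card ∧
        (A.filter fun z => ∃ x ∈ U, ω ∈ openConn x z).card ≤ j} +
      (prodBernoulli w).real {ω : BondConfig (Fin n) | (A.filter fun z => ω ∈ openConn q z).card ≤ j} ≤
    (prodBernoulli w).real {ω : BondConfig (Fin n) | (∀ x ∈ U, ω ∉ openConn q x) ∧
        (A.filter fun z => ω ∈ openConn q z).card ≤ j} +
      (prodBernoulli w).real {ω : BondConfig (Fin n) | (A.filter fun z => ω ∈ openConn c z).card ≤ j} := by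
  have key := CutObserver.observerSet_le_add_posPart w A U y q hy j
  have hmax : max ((prodBernoulli w).real {ω : BondConfig (Fin n) | (A.filter fun z => ω ∈ openConn y z).card ≤ j} -
      (prodBernoulli w).real {ω : BondConfig (Fin n) | (A.filter fun z => ω ∈ openConn q z).card ≤ j}) 0 ≤
      (prodBernoulli w).real {ω : BondConfig (Fin n) | (A.filter fun z => ω ∈ openConn c z).card ≤ j} -
      (prodBernoulli w).real {ω : BondConfig (Fin n) | (A.filter fun z => ω ∈ openConn q z).card ≤ j} :=
    max_le (by linarith) (by linarith)
  linarith

open CutObserver in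
/-- **CIL at `o` from the wall inequalities in the observer-deleted graph.**  Let `o ∉ A`, `c ∈ A`, and let
`w₀ = w ∖ o` (weights at `o` switched off: `fun e => if o ∉ e then w e else 0`), with `c` a level-`j` champion of `w₀`
(`r₀(a) ≤ r₀(c)` for all `a ∈ A`, `r₀` = lightness under `prodBernoulli w₀`).  Suppose that for every nonempty set `B` of
LIGHT positive-weight neighbours of `o` (`y ≠ o`, `w s(o,y) ≠ 0`, `r₀(c) < r₀(y)` for `y ∈ B`) the
set-champion-stability inequality holds under `prodBernoulli w₀`:
`μ₀(c ↮ B, 1 ≤ |π(B)| ≤ j) ≤ μ₀(c ↮ B, |π(c)| ≤ j)`  (= SQG at `q = c`, where its right-hand side vanishes).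
Then `μ_w{1 ≤ N ≤ j} ≤ μ_w{|π(c)| ≤ j}`: CIL_j at `o` with the witness `c` (the conclusion of `stub_cumulativeIsolation` at
this observer).  This is `Theorems.cil_of_starStability` with its hypothesis transported from the configuration
`ω ∩ {e | o ∉ e}` to the measure `prodBernoulli w₀` by `CutObserver.measureReal_preimage_avoid`.
[cite: VandenbergHaggstromKahn2005, Thm. 1.5 (p. 7); KozmaNitzan2024, Lemma 5 and Thm. 4 (pp. 13–14) — star decomposition] -/
theorem cil_of_setGap_deleted (w : Sym2 (Fin n) → unitInterval) (A : Finset (Fin n)) (o c : Fin n) (j : ℕ)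
    (hoA : o ∉ A) (hcA : c ∈ A)
    (hCS : ∀ B : Finset (Fin n), B.Nonempty →
      (∀ y ∈ B, y ≠ o ∧ w s(o, y) ≠ 0 ∧
        (prodBernoulli fun e => if e ∈ {e : Sym2 (Fin n) | o ∉ e} then w e else 0).real
            {ξ : BondConfig (Fin n) | (A.filter fun z => ξ ∈ openConn c z).card ≤ j} <
          (prodBernoulli fun e => if e ∈ {e : Sym2 (Fin n) | o ∉ e} then w e else 0).real
            {ξ : BondConfig (Fin n) | (A.filter fun z => ξ ∈ openConn y z).card ≤ j}) →
      (prodBernoulli fun e => if e ∈ {e : Sym2 (Fin n) | o ∉ e} then w e else 0).real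
          {ξ : BondConfig (Fin n) | (∀ x ∈ B, ξ ∉ openConn c x) ∧
            1 ≤ (A.filter fun z => ∃ x ∈ B, ξ ∈ openConn x z).card ∧
            (A.filter fun z => ∃ x ∈ B, ξ ∈ openConn x z).card ≤ j} ≤
        (prodBernoulli fun e => if e ∈ {e : Sym2 (Fin n) | o ∉ e} then w e else 0).real
          {ξ : BondConfig (Fin n) | (∀ x ∈ B, ξ ∉ openConn c x) ∧
            (A.filter fun z => ξ ∈ openConn c z).card ≤ j}) :
    (prodBernoulli w).real {ω : BondConfig (Fin n) |
        1 ≤ (A.filter fun x => ω ∈ openConn o x).card ∧ (A.filter fun x => ω ∈ openConn o x).card ≤ j} ≤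
      (prodBernoulli w).real {ω : BondConfig (Fin n) | (A.filter fun x => ω ∈ openConn c x).card ≤ j} := by
  have hco : c ≠ o := fun h => hoA (h ▸ hcA)
  refine cil_of_starStability w A o c j hoA hco ?_
  intro B hBne hB
  -- rewrite the `ω ∩ {e | o ∉ e}`-events as preimages and transport them to `prodBernoulli (w ∖ o)`
  have e1 : ∀ x : Fin n, {ω : BondConfig (Fin n) |
        (A.filter fun z => (openGraph (ω ∩ {e | o ∉ e})).Reachable x z).card ≤ j} =
      {ω : BondConfig (Fin n) | ω ∩ {e | o ∉ e} ∈
        {ξ : BondConfig (Fin n) | (A.filter fun z => ξ ∈ openConn x z).card ≤ j}} := by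
    intro x; ext ω; simp only [mem_setOf_eq, filter_avoid_eq]
  have hB' : ∀ y ∈ B, y ≠ o ∧ w s(o, y) ≠ 0 ∧
      (prodBernoulli fun e => if e ∈ {e : Sym2 (Fin n) | o ∉ e} then w e else 0).real
          {ξ : BondConfig (Fin n) | (A.filter fun z => ξ ∈ openConn c z).card ≤ j} <
        (prodBernoulli fun e => if e ∈ {e : Sym2 (Fin n) | o ∉ e} then w e else 0).real
          {ξ : BondConfig (Fin n) | (A.filter fun z => ξ ∈ openConn y z).card ≤ j} := by
    intro y hy
    obtain ⟨h1, h2, h3⟩ := hB y hy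
    refine ⟨h1, h2, ?_⟩
    rw [e1 c, e1 y, measureReal_preimage_avoid, measureReal_preimage_avoid] at h3
    exact h3
  have key := hCS B hBne hB'
  have e2 : {ω : BondConfig (Fin n) |
        (∀ y ∈ B, ¬ (openGraph (ω ∩ {e | o ∉ e})).Reachable c y) ∧
          1 ≤ (A.filter fun z => ∃ y ∈ B, (openGraph (ω ∩ {e | o ∉ e})).Reachable y z).card ∧
          (A.filter fun z => ∃ y ∈ B, (openGraph (ω ∩ {e | o ∉ e})).Reachable y z).card ≤ j} =
      {ω : BondConfig (Fin n) | ω ∩ {e | o ∉ e} ∈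
        {ξ : BondConfig (Fin n) | (∀ x ∈ B, ξ ∉ openConn c x) ∧
          1 ≤ (A.filter fun z => ∃ x ∈ B, ξ ∈ openConn x z).card ∧
          (A.filter fun z => ∃ x ∈ B, ξ ∈ openConn x z).card ≤ j}} := by
    ext ω; simp only [mem_setOf_eq, filter_avoid_exists_eq]; exact Iff.rfl
  have e3 : {ω : BondConfig (Fin n) |
        (∀ y ∈ B, ¬ (openGraph (ω ∩ {e | o ∉ e})).Reachable c y) ∧
          (A.filter fun z => (openGraph (ω ∩ {e | o ∉ e})).Reachable c z).card ≤ j} =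
      {ω : BondConfig (Fin n) | ω ∩ {e | o ∉ e} ∈
        {ξ : BondConfig (Fin n) | (∀ x ∈ B, ξ ∉ openConn c x) ∧
          (A.filter fun z => ξ ∈ openConn c z).card ≤ j}} := by
    ext ω; simp only [mem_setOf_eq, filter_avoid_eq]; exact Iff.rfl
  rw [e2, e3, measureReal_preimage_avoid, measureReal_preimage_avoid]
  exact key

/-- **SET-GAP STABILITY closes the crux.**  Hypothesis `hSQG` = the conjecture SQG of this seat, restricted to what is
needed: for every `n`, weights `w`, relay set `A`, level `j`, every nonempty vertex set `U` disjoint from `A` (a Steiner set;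
sets meeting `A` are `setGap_of_member_le`) and all relays `q, c ∈ A` with `c` a level-`j` champion,
`μ(q ↮ U, 1 ≤ |π(U)| ≤ j) + r(q) ≤ μ(q ↮ U, |π(q)| ≤ j) + r(c)`  (`Δ(U, q) ≤ r(c) − r(q)`).
Conclusion: the crux `NoHeavyLowerTail`.  Proof: at `q = c` the right-hand gap vanishes and SQG is the wall; with `c` a
champion of `w ∖ o`, `cil_of_setGap_deleted` gives CIL_j at every observer (`stub_cumulativeIsolation`), and
`Theorems.noHeavyLowerTail_of_stub_cumulativeIsolation` gives the crux.  The hull-port form HP-SQG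
(`max over the ports of U's Steiner hull` in place of `r(c)`) implies `hSQG`, ports being relays.
(Conditional reduction: SQG is a conjecture — 0 violations in this seat's exact census, not a theorem.)
[cite: VandenbergHaggstromKahn2005, Thm. 1.5 (p. 7); KozmaNitzan2024, Thm. 4 (p. 13) — witness = champion of `G ∖ 0`] -/
theorem noHeavyLowerTail_of_setGapStability
    (hSQG : ∀ (n : ℕ) (w : Sym2 (Fin n) → unitInterval) (A : Finset (Fin n)) (j : ℕ) (U : Finset (Fin n))
      (q c : Fin n), U.Nonempty → Disjoint U A → q ∈ A → c ∈ A →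
      (∀ a ∈ A, (prodBernoulli w).real {ω : BondConfig (Fin n) | (A.filter fun z => ω ∈ openConn a z).card ≤ j} ≤
        (prodBernoulli w).real {ω : BondConfig (Fin n) | (A.filter fun z => ω ∈ openConn c z).card ≤ j}) →
      (prodBernoulli w).real {ω : BondConfig (Fin n) | (∀ x ∈ U, ω ∉ openConn q x) ∧
          1 ≤ (A.filter fun z => ∃ x ∈ U, ω ∈ openConn x z).card ∧
          (A.filter fun z => ∃ x ∈ U, ω ∈ openConn x z).card ≤ j} +
        (prodBernoulli w).real {ω : BondConfig (Fin n) | (A.filter fun z => ω ∈ openConn q z).card ≤ j} ≤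
      (prodBernoulli w).real {ω : BondConfig (Fin n) | (∀ x ∈ U, ω ∉ openConn q x) ∧
          (A.filter fun z => ω ∈ openConn q z).card ≤ j} +
        (prodBernoulli w).real {ω : BondConfig (Fin n) | (A.filter fun z => ω ∈ openConn c z).card ≤ j}) :
    Summit.CriticalPhenomena.PercolationContinuityZ3.Theses.PercNearOneGluing.NoHeavyLowerTail := by
  refine noHeavyLowerTail_of_stub_cumulativeIsolation ?_
  intro n w A o j hA hoA
  -- the observer-deleted weights and their champion
  set w₀ : Sym2 (Fin n) → unitInterval := fun e => if e ∈ {e : Sym2 (Fin n) | o ∉ e} then w e else 0 with hw₀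
  set r₀ : Fin n → ℝ := fun x =>
    (prodBernoulli w₀).real {ξ : BondConfig (Fin n) | (A.filter fun z => ξ ∈ openConn x z).card ≤ j} with hr₀
  obtain ⟨c, hcA, hcmax⟩ := Finset.exists_max_image A r₀ hA
  refine ⟨c, hcA, cil_of_setGap_deleted w A o c j hoA hcA ?_⟩
  intro B hBne hB
  -- `B` consists of non-relays: a relay `y ∈ B` would have `r₀(y) ≤ r₀(c)`, contradicting lightness
  have hBA : Disjoint B A := by
    rw [Finset.disjoint_left]
    intro y hyB hyA
    have h1 := hcmax y hyA
    have h2 := (hB y hyB).2.2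
    simp only [hr₀] at h1
    exact absurd h1 (not_le.2 h2)
  have key := hSQG n w₀ A j B c c hBne hBA hcA hcA (fun a ha => hcmax a ha)
  linarith

end Summit.CriticalPhenomena.PercolationContinuityZ3.Theorems

end
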